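import Summits.CriticalPhenomena.CardyFormulaZ2.Theorems.CardyIKTransportIKLinearTransportStubCouplingToLimitsEvents
import Summits.CriticalPhenomena.CardyFormulaZ2.Theorems.CardyIKTransportIKMixedBoxCrossingDefs

/-!
# Stub `stub_monotone` (line `paired-mirror-exploration`, crux `IKMixedBoxCrossing`, stmt-CriticalPhenomena-5911)

Support file (`--supports stmt-CriticalPhenomena-5911`): crossing a LONGER box the long way is harder.
For `1 ≤ w ≤ w'` the black left–right crossing event of the `w' × h` box at `(a, b)` is CONTAINED in that
of the `w × h` box at `(a, b)` (`lrCross_subset`): an open path of `blackEdges x` from column `a` to column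
`a + w' - 1` inside the wider box changes its first coordinate by at most `1` along every edge
(`apply_le_of_mk_mem_blackEdges`), so — a discrete intermediate-value argument along the walk,
`exists_reachable_level` — it visits column `a + w - 1`, and its initial segment up to the first visit is an
open path of the narrower box.  Monotonicity of the measure `μIK` (`measureReal_mono`, a probability measure)
gives `pLR S a b w' h ≤ pLR S a b w h`; heights and `pTB` likewise (`tbCross_subset`).
-/

noncomputable section

namespace Summit.CriticalPhenomena.CardyFormulaZ2.Cruxes.IKMixedBoxCrossing.PairedMirrorExploration

open MeasureTheory
open Literature.Probability.Percolation Literature.Probability.LatticeModels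
open Summit.CriticalPhenomena.CardyFormulaZ2.Theorems.IKLinearTransport.PinnedDiagramExchange
  (Ω μIK Obs obs blackEdges lrCross tbCross)
open Summit.CriticalPhenomena.CardyFormulaZ2.Theorems.IKLinearTransport.PinnedDiagramExchange.CouplingToLimits
  (mk_mem_blackEdges_iff isProbabilityMeasure_μIK)

namespace MonotoneStub

/-! ## A discrete intermediate-value lemma for walks in induced subgraphs -/

/-- DISCRETE INTERMEDIATE VALUE ALONG A WALK.  If every edge of `G` raises the integer label `f` by at
most `1`, a walk of `G` inside `S` from a vertex of label `≤ c` to a vertex of label `≥ c` visits a vertex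
`w` of label exactly `c`, and its initial segment up to the first such visit is a walk inside any `T`
containing the vertices of `S` of label `≤ c`. [folklore] -/
theorem exists_reachable_level {V : Type*} {G : SimpleGraph V} {f : V → ℤ}
    (hf : ∀ x y, G.Adj x y → f y ≤ f x + 1) {S T : Set V} {c : ℤ} (hT : ∀ z ∈ S, f z ≤ c → z ∈ T)
    {u v : S} (p : (G.induce S).Walk u v) (hu : f u ≤ c) (hv : c ≤ f v) :
    ∃ (w : V) (hw : w ∈ T) (hu' : (u : V) ∈ T), f w = c ∧ (G.induce T).Reachable ⟨u, hu'⟩ ⟨w, hw⟩ := by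
  induction p with
  | nil => exact ⟨_, hT _ (Subtype.coe_prop _) hu, hT _ (Subtype.coe_prop _) hu, le_antisymm hu hv, .refl _⟩
  | @cons x y z hxy p ih =>
    rcases eq_or_lt_of_le hu with hfx | hfx
    · exact ⟨_, hT _ x.2 hu, hT _ x.2 hu, hfx, .refl _⟩
    · have hGxy : G.Adj x y := hxy
      have hy : f y ≤ c := by have := hf x y hGxy; omega
      obtain ⟨w, hw, hyT, hfw, hr⟩ := ih hy hv
      have hadj : (G.induce T).Adj ⟨x, hT _ x.2 hu⟩ ⟨y, hyT⟩ := hGxy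
      exact ⟨w, hw, hT _ x.2 hu, hfw, hadj.reachable.trans hr⟩

/-- Along an edge of `blackEdges x` both coordinates increase by at most `1` (the steps are
`(1,0), (0,1), (1,1), (1,-1)` up to orientation). [folklore] -/
theorem apply_le_of_mk_mem_blackEdges {x : Obs} {p q : Site 2} (h : s(p, q) ∈ blackEdges x) :
    q 0 ≤ p 0 + 1 ∧ q 1 ≤ p 1 + 1 := by
  rcases (mk_mem_blackEdges_iff x p q).1 h with ⟨-, -, hr⟩ | ⟨-, -, hr⟩
  · rcases hr with rfl | rfl | ⟨rfl, -⟩ | ⟨rfl, -⟩ <;> simp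
  · rcases hr with rfl | rfl | ⟨rfl, -⟩ | ⟨rfl, -⟩ <;> simp <;> omega

/-- The first coordinate increases by at most `1` along an open edge. [folklore] -/
theorem apply_zero_le_of_adj (x : Obs) (p q : Site 2) (h : (openGraph (blackEdges x)).Adj p q) :
    q 0 ≤ p 0 + 1 :=
  (apply_le_of_mk_mem_blackEdges ((openGraph_adj _ _ _).1 h).1).1

/-- The second coordinate increases by at most `1` along an open edge. [folklore] -/
theorem apply_one_le_of_adj (x : Obs) (p q : Site 2) (h : (openGraph (blackEdges x)).Adj p q) :
    q 1 ≤ p 1 + 1 :=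
  (apply_le_of_mk_mem_blackEdges ((openGraph_adj _ _ _).1 h).1).2

/-! ## Event inclusions -/

/-- WIDTH: a black LR crossing of the `w' × h` box at `(a,b)` is (contains) a black LR crossing of the
`w × h` box at `(a,b)` whenever `1 ≤ w ≤ w'`. [folklore] -/
theorem lrCross_subset {a b : ℤ} {w w' h : ℕ} (hw : 1 ≤ w) (hww' : w ≤ w') :
    lrCross a b w' h ⊆ lrCross a b w h := by
  intro x hx
  simp only [lrCross, Set.mem_setOf_eq, mem_openCrossing_iff] at hx ⊢
  obtain ⟨u, ⟨hu0, hu1, hu2⟩, v, ⟨hv0, hv1, hv2⟩, huS, hvS, ⟨p⟩⟩ := hx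
  have hww'Z : (w : ℤ) ≤ w' := by exact_mod_cast hww'
  have hwZ : (1 : ℤ) ≤ w := by exact_mod_cast hw
  obtain ⟨z, hz, huT, hfz, hr⟩ := exists_reachable_level (apply_zero_le_of_adj x)
    (S := {v : Site 2 | a ≤ v 0 ∧ v 0 < a + w' ∧ b ≤ v 1 ∧ v 1 < b + h})
    (T := {v : Site 2 | a ≤ v 0 ∧ v 0 < a + w ∧ b ≤ v 1 ∧ v 1 < b + h}) (c := a + w - 1)
    (fun z hz hzc => ⟨hz.1, by omega, hz.2.2⟩) (u := ⟨u, huS⟩) (v := ⟨v, hvS⟩) p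
    (by simp only; omega) (by simp only; omega)
  exact ⟨u, ⟨hu0, hu1, hu2⟩, z, ⟨hfz, hz.2.2⟩, huT, hz, hr⟩

/-- HEIGHT: a black BT crossing of the `w × h'` box at `(a,b)` is (contains) a black BT crossing of the
`w × h` box at `(a,b)` whenever `1 ≤ h ≤ h'`. [folklore] -/
theorem tbCross_subset {a b : ℤ} {w h h' : ℕ} (hh : 1 ≤ h) (hhh' : h ≤ h') :
    tbCross a b w h' ⊆ tbCross a b w h := by
  intro x hx
  simp only [tbCross, Set.mem_setOf_eq, mem_openCrossing_iff] at hx ⊢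
  obtain ⟨u, ⟨hu0, hu1, hu2⟩, v, ⟨hv0, hv1, hv2⟩, huS, hvS, ⟨p⟩⟩ := hx
  have hhh'Z : (h : ℤ) ≤ h' := by exact_mod_cast hhh'
  have hhZ : (1 : ℤ) ≤ h := by exact_mod_cast hh
  obtain ⟨z, hz, huT, hfz, hr⟩ := exists_reachable_level (apply_one_le_of_adj x)
    (S := {v : Site 2 | a ≤ v 0 ∧ v 0 < a + w ∧ b ≤ v 1 ∧ v 1 < b + h'})
    (T := {v : Site 2 | a ≤ v 0 ∧ v 0 < a + w ∧ b ≤ v 1 ∧ v 1 < b + h}) (c := b + h - 1)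
    (fun z hz hzc => ⟨hz.1, hz.2.1, hz.2.2.1, by omega⟩) (u := ⟨u, huS⟩) (v := ⟨v, hvS⟩) p
    (by simp only; omega) (by simp only; omega)
  exact ⟨u, ⟨hu0, hu1, hu2⟩, z, ⟨hfz, hz.1, hz.2.1⟩, huT, hz, hr⟩

end MonotoneStub

/-- **STUB 4 · `stub_monotone`** (= `Monotone'`): `pLR S a b · h` is antitone in the width on `1 ≤ w`
and `pTB S a b w ·` is antitone in the height on `1 ≤ h`, for every column pattern `S` — by the event
inclusions `MonotoneStub.lrCross_subset` / `MonotoneStub.tbCross_subset` and monotonicity of the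
probability measure `μIK`. [folklore] -/
theorem stub_monotone :
    (∀ (S : Set ℤ) (a b : ℤ) (w w' h : ℕ), 1 ≤ w → w ≤ w' → pLR S a b w' h ≤ pLR S a b w h) ∧
    (∀ (S : Set ℤ) (a b : ℤ) (w h h' : ℕ), 1 ≤ h → h ≤ h' → pTB S a b w h' ≤ pTB S a b w h) := by
  haveI := isProbabilityMeasure_μIK
  refine ⟨fun S a b w w' h hw hww' => ?_, fun S a b w h h' hh hhh' => ?_⟩
  · exact measureReal_mono (Set.preimage_mono (MonotoneStub.lrCross_subset hw hww'))
  · exact measureReal_mono (Set.preimage_mono (MonotoneStub.tbCross_subset hh hhh'))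

end Summit.CriticalPhenomena.CardyFormulaZ2.Cruxes.IKMixedBoxCrossing.PairedMirrorExploration

end
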